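import Summits.QuantumFields.YangMills.Theorems.GrossTransferStubLinTestPointwisePairing
import Summits.QuantumFields.YangMills.Theorems.GrossTransferStubLinTestPointwiseMasses
import Summits.QuantumFields.YangMills.Theorems.GrossTransferStubLinTestPointwiseNumbers
import Summits.QuantumFields.YangMills.Theorems.GrossTransferStubLinTestProxySide
import Summits.QuantumFields.YangMills.Theorems.GrossTransferStubLinTestWindows
import Summits.QuantumFields.YangMills.Theorems.GrossTransferStubLinTestCollarTerm
import Summits.QuantumFields.YangMills.Theorems.GrossTransferStubLinTestAssembly
import Summits.QuantumFields.YangMills.Theorems.UnitScaleGibbsBlockPlaquetteLinWeightSupport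
import Summits.QuantumFields.YangMills.Theorems.UnitScaleGibbsChartPairingDictionary
import HarnessLib

/-!
# `GrossTransferStubLinTestPointwiseRow` — R8-P8 OF `stub_linTest`'s POINTWISE PACKAGE, PART (P): THE POINTWISE ROW, ASSEMBLED
# (LINE 28 «GrossTransfer» v3.2, skeleton of record `Cruxes/HistoryTailL/Lines/gross_transfer.lean`; crux `RevelationMartingale.MeanDeviationL`
# stmt-QuantumFields-23083 ∕ `UnitScaleTilt.HistoryTailL` stmt-QuantumFields-19936)

Cell `ym3-torus` (YM ladder rung R3 = continuum SU(2) Yang–Mills on T³ — a RUNG, NOT the Clay problem: not d = 4, not infinite volume, not a mass gap);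
width seat `ym3-torus-px13` g12, pen on `main_estimate` (LEAD ★w1-19936 00:19:30Z ∕ ★★OWNER WORD 65), helper `--supports stmt-QuantumFields-23083`; part (P) of
the ≤ 400-line split (w2 g16: (W)(Q) ✓Assembly; px13: (I-a)(I-b)(N), this file, MAIN).  THEOREMS ONLY (0 `def`, 0 `sorry`; one decl-local 400 k heartbeat budget).

WHAT.  ★★★`pointwise_row` — row (R8) of `main_estimate` from the package's letters as BINDERS (cone `cn` under `a` with base `castSite z₀`, radii
`R₀`, `R = (R₀+12)L^{3j}`, `ℓ0 = R₀+2`, box `lo = z₀ − (3R+2)`, `hi = z₀ + (3R+4)`, `n = 6R+6`; read-out `wt`, potential `βt`, `at'`, `γt`, cutoff `χ`,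
`aR = χ·at'`, `daR`, push `u0`, commutators `E₁, C₂, σ, δσ`, collar mass `W`, weights' push `ω`; constants `36 ≤ C`, `C8 = 3CE² ≤ C`,
`CE = 3244536(K₀+26C₁) + ½ + L¹⁹`; window `260·j ≤ K`): on `PlaqSmallOn (boxPlaqs lo hi) (γL^{−K})^{3∕8} U`, with `V = U^{axialGauge U lo hi}`,
`dist₁(Ū^j(U)∂a)² ≤ C·Σ_α (∂_{u0•iσ_α}A(V))² + Σ_b (9∕2)ω_b·dist₁(V_b)² + C·γ·L^{−(K−j)}`.  CHAIN: (Q) ✓`proxy_side` → ✓KNIT-E2a → (I-a) → ✓P6∕✓P7 →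
(I-b) → ✓`sq_le_of_rows` → (N) + (W) ✓`rem_le` → ✓`sq_le_of_window'` → ✓`sum_box_mul_le_sum_pbond` (`864 = (9∕2)·192`) → `x·L^j = γ·L^{−(K−j)}`.

HONEST SCOPE.  Bookkeeping about ONE configuration; `stub_linTest`, 23083, 19936, `YM3TorusSU2`, any summit statement, the mass gap: NOT proved here.
References: [GrossCMP1983] Thm 2.2; [Balaban1985Averaging] Prop. 1 (51) pp. 25–26, (19)–(20) p. 21; [Balaban1987RG1] (0.1)–(0.4) pp. 251–253.
-/

noncomputable section

set_option autoImplicit false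

open MeasureTheory
open scoped BigOperators Matrix.Norms.L2Operator
open Complex Finset
open Literature.Probability.LatticeModels (latticeGreen)
open Literature.MathematicalPhysics.QuantumFieldTheory.Balaban1983to89
open Literature.MathematicalPhysics.QuantumFieldTheory.Balaban1983to89.T3ContinuumYM3Torus
open Literature.MathematicalPhysics.QuantumFieldTheory.Balaban1983to89.T3UnitLawDensityEML (ℰp)
open Literature.MathematicalPhysics.QuantumFieldTheory.Balaban1983to89.B4Eq19LatticeOperators (Zd unitVec box mem_box box_mono abs_unitVec_apply_le)
open Literature.MathematicalPhysics.QuantumFieldTheory.Balaban1983to89.T4AxialGaugeSmallField (castSite boxPlaqs boxBonds axialGauge)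
open Literature.MathematicalPhysics.QuantumFieldTheory.Balaban1983to89.B7Prop1Explicit (e)
open Literature.MathematicalPhysics.QuantumFieldTheory.Balaban1983to89.B10Eq18SigmaSU2 (pauli)
open Literature.MathematicalPhysics.QuantumLattice (fundamentalRep)
open Summit.QuantumFields.YangMills.Theorems.UnitScaleGibbsActionDerivativeSlotCalculus (actionDeriv)
open Summit.QuantumFields.YangMills.Theorems.UnitScaleGibbsBlockPlaquetteLinWeight (linWeight)

namespace Summit.QuantumFields.YangMills.Theorems.GrossTransferStubLinTestPointwiseRow

set_option maxHeartbeats 400000 in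
/-- ★★★ **ROW (R8) OF `main_estimate` — THE POINTWISE INEQUALITY ON THE SMALL-FIELD EVENT**, from the package's letters as binders (module docstring).
[cite: GrossCMP1983, Thm 2.2] [cite: Balaban1985Averaging, Prop. 1 (51) pp.25-26] -/
theorem pointwise_row (F : T3Family) (K : ℕ) {L : ℕ} (hFL : F.L = L) {γ : ℝ} (hγ : 0 < γ) (hγ8 : γ ≤ 1 / 8)
    {j : ℕ} (hj : 1 ≤ j) (hKj : 260 * j ≤ K) (a : Plaq (F.P K) j)
    (cn : (i : ℕ) → Site (F.P K) i) (hcnj : cn j = a.src) (hcn : ∀ i, i < j → cn i = emb (cn (i + 1)))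
    (z₀ : Zd (F.P K).d) (hz₀ : cn 0 = castSite z₀)
    (R₀ : ℕ) (hR₀ : R₀ = (((F.P K).d + 4) * (F.P K).L + 2) * ∑ k ∈ Finset.range j, (F.P K).L ^ k)
    (R : ℕ) (hR : R = (R₀ + 12) * (F.P K).L ^ (3 * j))
    {lo hi : Fin (F.P K).d → ℤ} (hlo : ∀ κ, lo κ = z₀ κ - (3 * (R : ℤ) + 2)) (hhi : ∀ κ, hi κ = z₀ κ + (3 * (R : ℤ) + 4))
    {n : ℕ} (hn : n = 6 * R + 6) (hbox : ∀ κ, hi κ ≤ lo κ + n) (hnN : n < (F.P K).sitesPerDir 0) (hNbox : ∀ κ, hi κ - lo κ < (F.P K).sitesPerDir 0)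
    (ℓ0 : ℕ) (hℓ0 : ℓ0 = R₀ + 2) (hℓ0lt : 2 * (ℓ0 : ℤ) < (F.P K).sitesPerDir 0)
    (wt βt : Zd (F.P K).d → Fin (F.P K).d → Fin (F.P K).d → ℝ) (at' : Zd (F.P K).d → Fin (F.P K).d → ℝ)
    (γt : Zd (F.P K).d → Fin (F.P K).d → Fin (F.P K).d → Fin (F.P K).d → ℝ)
    (hwt : ∀ y μ ν, wt y μ ν =
      if y ∈ box z₀ (ℓ0 : ℤ) then
        (if h : μ < ν then linWeight j a ⟨castSite y, μ, ν, h⟩ else if h' : ν < μ then -linWeight j a ⟨castSite y, ν, μ, h'⟩ else 0)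
      else 0)
    (hβt : ∀ x μ ν, βt x μ ν = ∑ y ∈ box z₀ (ℓ0 : ℤ), latticeGreen (x - y) / 2 * wt y μ ν)
    (hat : ∀ x ν, at' x ν = ∑ μ, (βt (x - unitVec μ) μ ν - βt x μ ν))
    (hγt : ∀ x κ μ ν, γt x κ μ ν = (βt (x + unitVec κ) μ ν - βt x μ ν) - (βt (x + unitVec μ) κ ν - βt x κ ν) + (βt (x + unitVec ν) κ μ - βt x κ μ))
    (χ : Zd (F.P K).d → ℝ) (hχ01 : ∀ x, 0 ≤ χ x ∧ χ x ≤ 1) (hχ1 : ∀ x ∈ box z₀ (R : ℤ), χ x = 1) (hχ0 : ∀ x, x ∉ box z₀ (3 * (R : ℤ)) → χ x = 0)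
    (aR : Zd (F.P K).d → Fin (F.P K).d → ℝ) (haR : ∀ x ν, aR x ν = χ x * at' x ν) (daR : Zd (F.P K).d → Fin (F.P K).d → Fin (F.P K).d → ℝ)
    (hdaR : ∀ x μ ν, daR x μ ν = (aR (x + unitVec μ) ν - aR x ν) - (aR (x + unitVec ν) μ - aR x μ))
    (haR1 : ∀ x μ, aR x μ ≠ 0 → lo + 1 ≤ x ∧ x + unitVec μ + 1 ≤ hi)
    (u0 : PBond (F.P K) 0 → ℝ)
    (hu0 : ∀ (x : Fin (F.P K).d → ℤ) (μ : Fin (F.P K).d), lo ≤ x → x + e μ ≤ hi → u0 ⟨castSite x, μ⟩ = aR x μ)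
    (hu0off : ∀ b : PBond (F.P K) 0, (¬ ∃ y : Fin (F.P K).d → ℤ, lo ≤ y ∧ y + e b.dir ≤ hi ∧ b.src = castSite y) → u0 b = 0)
    (E1 C2 σ : Zd (F.P K).d → Fin (F.P K).d → Fin (F.P K).d → ℝ) (δσ : Zd (F.P K).d → Fin (F.P K).d → ℝ)
    (hE1 : ∀ x μ ν, E1 x μ ν = (χ (x + unitVec μ) - χ x) * at' (x + unitVec μ) ν - (χ (x + unitVec ν) - χ x) * at' (x + unitVec ν) μ)
    (hC2 : ∀ x μ ν, C2 x μ ν = ∑ κ, (χ x - χ (x - unitVec κ)) * γt (x - unitVec κ) κ μ ν)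
    (hσ : ∀ x μ ν, σ x μ ν = E1 x μ ν - C2 x μ ν) (hδσ : ∀ y ν, δσ y ν = ∑ μ, (σ (y - unitVec μ) μ ν - σ y μ ν))
    (W : ℝ) (hW : W = ∑ y ∈ box z₀ (3 * (R : ℤ) + 2), ∑ ν, |δσ y ν|) (ω : PBond (F.P K) 0 → ℝ)
    (hω : ∀ (x : Fin (F.P K).d → ℤ) (μ : Fin (F.P K).d), lo ≤ x → x + e μ ≤ hi → ω ⟨castSite x, μ⟩ = 192 * W * |δσ x μ|)
    (hωoff : ∀ b : PBond (F.P K) 0, (¬ ∃ y : Fin (F.P K).d → ℤ, lo ≤ y ∧ y + e b.dir ≤ hi ∧ b.src = castSite y) → ω b = 0)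
    (hM0 : ∑ μ, ∑ ν', ∑ y ∈ box z₀ (ℓ0 : ℤ), |wt y μ ν'| ≤ 9 * ((L : ℝ) ^ 2) ^ j)
    {C₁k : ℝ} (hC₁k : 0 ≤ C₁k)
    (hK1 : ∀ (e : Fin 3) (w : Zd 3) (m : ℕ), 1 ≤ m → w ∉ box (0 : Zd 3) ((m : ℤ) - 1) →
      |latticeGreen (w + unitVec e) - latticeGreen w| ≤ C₁k / (m : ℝ) ^ 2)
    (K₀ : ℝ) (hK₀ : K₀ = ∑ e' : Fin 3, |latticeGreen (unitVec e') - latticeGreen (0 : Zd 3)|)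
    {C C8 CE : ℝ} (hCE : CE = 3244536 * (K₀ + 26 * C₁k) + 1 / 2 + (L : ℝ) ^ 19) (hC8 : C8 = 3 * CE ^ 2) (hCge8 : C8 ≤ C) (hCge36 : 36 ≤ C)
    (U : GaugeField (F.P K) 0 (Matrix.specialUnitaryGroup (Fin 2) ℂ)) (hU : PlaqSmallOn (boxPlaqs lo hi) ((γ * ((L : ℝ)⁻¹) ^ K) ^ ((3 : ℝ) / 8)) U) :
    (GaugeGroup.dist1 (GaugeField.plaqHol (Averaging.iter (fun i' => BlockAveraging.blockAvg (P := F.P K) (j := i') ℰp) j U) a)) ^ 2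
      ≤ C * ∑ α : Fin 3, (actionDeriv (fundamentalRep (Fin 2)) (fun b => ((u0 b : ℝ) : ℂ) • (I • pauli α)) (GaugeField.gaugeAct (axialGauge U lo hi) U)) ^ 2
        + ∑ b, (9 / 2 * ω b) * (GaugeGroup.dist1 (GaugeField.gaugeAct (axialGauge U lo hi) U b)) ^ 2
        + C * (γ * ((L : ℝ)⁻¹) ^ (K - j)) := by
  classical
  have hd : (F.P K).d = 3 := rfl
  have hPL : ((F.P K).L : ℝ) = (L : ℝ) := by rw [← hFL]; rfl
  have hL1 : (1 : ℝ) ≤ (L : ℝ) := by rw [← hFL]; exact_mod_cast (le_trans (by norm_num) F.hL.2)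
  have hL2r : (2 : ℝ) ≤ (L : ℝ) := by rw [← hFL]; exact_mod_cast F.hL.2
  have hK₀0 : 0 ≤ K₀ := by rw [hK₀]; exact Finset.sum_nonneg fun _ _ => abs_nonneg _
  -- letters of the event
  obtain ⟨x, hx⟩ : ∃ x : ℝ, x = γ * ((L : ℝ)⁻¹) ^ K := ⟨_, rfl⟩
  obtain ⟨θ, hθ⟩ : ∃ θ : ℝ, θ = (γ * ((L : ℝ)⁻¹) ^ K) ^ ((3 : ℝ) / 8) := ⟨_, rfl⟩
  have hθ0 : 0 ≤ θ := by rw [hθ]; exact Real.rpow_nonneg (by rw [← hFL]; positivity) _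
  have hU' : PlaqSmallOn (boxPlaqs lo hi) θ U := by rw [hθ]; exact hU
  set V := GaugeField.gaugeAct (axialGauge U lo hi) U with hV
  have hjK : j ≤ (F.P K).m + (F.P K).K := by
    have : (F.P K).K = K := rfl
    rw [this]; omega
  -- the `y`-letters and the windows (✓(W))
  have hX0 : 0 < x := by rw [hx]; positivity
  have hX1 : x ≤ ((L : ℝ)⁻¹) ^ K := by
    rw [hx]
    calc γ * ((L : ℝ)⁻¹) ^ K ≤ 1 * ((L : ℝ)⁻¹) ^ K := by gcongr; linarith only [hγ8]
      _ = ((L : ℝ)⁻¹) ^ K := one_mul _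
  obtain ⟨y, hy0, hy16, hθy⟩ := GrossTransferStubLinTestWindows.exists_sixteenth_root hX0 (by rw [hθ, hx] : θ = x ^ ((3 : ℝ) / 8))
  have hwinNat : ∀ a b : ℕ, a ≤ K * b → (L : ℝ) ^ a * x ^ b ≤ 1 := GrossTransferStubLinTestWindows.winNat hL1 hX0.le hX1
  have hR₀le : R₀ ≤ (7 * F.L + 2) * F.L ^ j := by rw [hR₀]; exact GrossTransferStubLinTestWindows.radius_le (F.P K) hd j
  have hnle : (n : ℝ) ≤ (42 * (L : ℝ) + 96) * (L : ℝ) ^ (4 * j) := by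
    have h := GrossTransferStubLinTestWindows.side_le F.hL.2 hR₀le
    have hPLn : (F.P K).L = F.L := rfl
    rw [← hPLn, ← hR, ← hn, hPLn, hFL] at h
    exact_mod_cast h
  have hcore9 := GrossTransferStubLinTestWindows.pow_mul_y6_le_one hL1 hy0 hy16 hwinNat (23 * j + 9) (by omega)
  have hcore15 := GrossTransferStubLinTestWindows.pow_mul_y6_le_one hL1 hy0 hy16 hwinNat (23 * j + 15) (by omega)
  have hcore18 := GrossTransferStubLinTestWindows.pow_mul_y6_le_one hL1 hy0 hy16 hwinNat (23 * j + 18) (by omega)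
  have hwin := GrossTransferStubLinTestWindows.ploc_window (F.P K) hd (L : ℝ) hPL hnle hθy hy0.le hcore9
  have hwinδ := GrossTransferStubLinTestWindows.ploc_window_delta (F.P K) hd (L : ℝ) hPL hnle hθy hy0.le hcore18
  have hsmall := GrossTransferStubLinTestWindows.eta_le_one (F.P K) hθ0 hwin
  have hsmall4 := GrossTransferStubLinTestWindows.four_eta_le_one (F.P K) hd (L : ℝ) hPL hnle hθy hy0.le hcore15
  -- radii: `ℓ0 ≤ R`, `R₀ ≤ R ≤ 3R+2`, P-LOC's margins
  have hℓR : (ℓ0 : ℤ) ≤ (R : ℤ) := by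
    have hLpos : 0 < (F.P K).L ^ (3 * j) := pow_pos (lt_of_lt_of_le (by norm_num) F.hL.2) _
    have : ℓ0 ≤ R := by
      rw [hℓ0, hR]
      calc R₀ + 2 ≤ R₀ + 12 := by omega
        _ ≤ (R₀ + 12) * (F.P K).L ^ (3 * j) := Nat.le_mul_of_pos_right _ hLpos
    exact_mod_cast this
  have hR0 : (0 : ℤ) ≤ (R : ℤ) := Nat.cast_nonneg R
  have hR₀R : (R₀ : ℤ) ≤ R := by
    have hℓ : (ℓ0 : ℤ) = R₀ + 2 := by rw [hℓ0]; push_cast; ring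
    linarith only [hℓR, hℓ]
  have hlo' : ∀ κ, lo κ + ((((F.P K).d + 4) * (F.P K).L + 2) * ∑ k ∈ Finset.range j, (F.P K).L ^ k : ℕ) ≤ z₀ κ := by
    intro κ; rw [← hR₀, hlo κ]; linarith only [hR₀R, hR0]
  have hhi' : ∀ κ, z₀ κ + ((((F.P K).d + 4) * (F.P K).L + 2) * ∑ k ∈ Finset.range j, (F.P K).L ^ k : ℕ) + 2 ≤ hi κ := by
    intro κ; rw [← hR₀, hhi κ]; linarith only [hR₀R, hR0]
  -- (Q) THE PROXY SIDE (P1a + P1b + P2 + the second-order term): `D ≤ Σ_α |Σ_p w_p·F^α_p| + ½(L·L)^jθ² + ρ₁`, `0 ≤ ρ₁`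
  obtain ⟨hD, hρ0⟩ := GrossTransferStubLinTestProxySide.proxy_side U hbox hnN hθ0 hU' hjK a cn hcnj hcn z₀ hz₀ hlo' hhi' hwin hwinδ
  rw [← hV] at hD
  -- (P3) THE TORUS PAIRINGS READ ON `ℤ³` (✓KNIT-E2a): the antisymmetrised read-out `F̂^α` and `Σ_p w_p F^α_p = ½Σ_{Q_{ℓ0}} wt·F̂^α`
  obtain ⟨Fh, hFh⟩ : ∃ Fh : Fin 3 → (Fin (F.P K).d → ℤ) → Fin (F.P K).d → Fin (F.P K).d → ℝ, ∀ α z μ ν, Fh α z μ ν =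
      if h : μ < ν then ((I • pauli α) * (((GaugeField.plaqHol V ⟨castSite z, μ, ν, h⟩ : Matrix.specialUnitaryGroup (Fin 2) ℂ) :
        Matrix (Fin 2) (Fin 2) ℂ) - 1)).trace.re
      else if h' : ν < μ then -((I • pauli α) * (((GaugeField.plaqHol V ⟨castSite z, ν, μ, h'⟩ :
        Matrix.specialUnitaryGroup (Fin 2) ℂ) : Matrix (Fin 2) (Fin 2) ℂ) - 1)).trace.re else 0 := ⟨_, fun _ _ _ _ => rfl⟩
  obtain ⟨W', hW'⟩ : ∃ W' : (Fin (F.P K).d → ℤ) → Fin (F.P K).d → Fin (F.P K).d → ℝ, ∀ z μ ν, W' z μ ν =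
      if h : μ < ν then linWeight j a ⟨castSite z, μ, ν, h⟩ else if h' : ν < μ then -linWeight j a ⟨castSite z, ν, μ, h'⟩ else 0 := ⟨_, fun _ _ _ => rfl⟩
  have hW'wt : ∀ z ∈ box z₀ (ℓ0 : ℤ), ∀ μ ν, wt z μ ν = W' z μ ν := fun z hz μ ν => by rw [hwt, hW']; simp only [hz, ↓reduceIte]
  have hwt_off : ∀ x, x ∉ box z₀ (ℓ0 : ℤ) → ∀ μ ν, wt x μ ν = 0 := fun x hx μ ν => by rw [hwt]; simp only [hx, ↓reduceIte]
  have hanti : ∀ {A : Fin (F.P K).d → Fin (F.P K).d → ℝ} (g : ∀ μ ν : Fin (F.P K).d, μ < ν → ℝ),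
      (∀ μ ν, A μ ν = if h : μ < ν then g μ ν h else if h' : ν < μ then -g ν μ h' else 0) → ∀ μ ν, A ν μ = -A μ ν := by
    intro A g hA μ ν
    rw [hA, hA]
    by_cases h1 : μ < ν
    · have h2 : ¬ ν < μ := not_lt.mpr h1.le
      simp only [h1, h2, ↓reduceDIte]
    · by_cases h2 : ν < μ
      · simp only [h1, h2, ↓reduceDIte, neg_neg]
      · simp only [h1, h2, ↓reduceDIte, neg_zero]
  have hFh_lt : ∀ α y (μ ν : Fin (F.P K).d) (h : μ < ν), Fh α y μ ν =
      ((I • pauli α) * (((GaugeField.plaqHol V ⟨castSite y, μ, ν, h⟩ : Matrix.specialUnitaryGroup (Fin 2) ℂ) : Matrix (Fin 2) (Fin 2) ℂ) - 1)).trace.re :=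
    fun α y μ ν h => by rw [hFh]; simp only [h, ↓reduceDIte]
  have hFha : ∀ α y μ ν, Fh α y ν μ = -Fh α y μ ν := fun α y =>
    hanti (fun μ ν h => ((I • pauli α) * (((GaugeField.plaqHol V ⟨castSite y, μ, ν, h⟩ : Matrix.specialUnitaryGroup (Fin 2) ℂ) :
      Matrix (Fin 2) (Fin 2) ℂ) - 1)).trace.re) (hFh α y)
  have hwt_anti : ∀ y μ ν, wt y ν μ = -wt y μ ν := by
    intro y μ ν
    by_cases hy : y ∈ box z₀ (ℓ0 : ℤ)
    · rw [hW'wt y hy, hW'wt y hy]; exact hanti (fun μ ν h => linWeight j a ⟨castSite y, μ, ν, h⟩) (hW' y) μ ν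
    · rw [hwt_off y hy, hwt_off y hy, neg_zero]
  have hβanti : ∀ x μ ν, βt x ν μ = -βt x μ ν := by
    intro x μ ν
    rw [hβt, hβt, ← Finset.sum_neg_distrib]
    exact Finset.sum_congr rfl fun y _ => by rw [hwt_anti]; ring
  have hconeT : ∀ p : Plaq (F.P K) 0, linWeight j a p ≠ 0 → p ∈ boxPlaqs (fun κ => z₀ κ - (ℓ0 : ℤ)) (fun κ => z₀ κ + (ℓ0 : ℤ)) := by
    intro p hp
    obtain ⟨-, -, y, hy, hsrc⟩ := UnitScaleGibbsBlockPlaquetteLinWeightSupport.exists_castSite_of_linWeight_ne_zero j a cn hcnj hcn z₀ hz₀ p hp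
    rw [← hR₀] at hy
    have hℓ : (ℓ0 : ℤ) = R₀ + 2 := by rw [hℓ0]; push_cast; ring
    refine ⟨y, fun κ => ?_, fun κ => ?_, hsrc⟩
    · have h := hy κ; rw [abs_le] at h; simp only; linarith only [h.1, hℓ]
    · have h := hy κ; rw [abs_le] at h
      have h1 : (e p.μ : Fin (F.P K).d → ℤ) κ ≤ 1 := le_trans (le_abs_self _) (abs_unitVec_apply_le p.μ κ)
      have h2 : (e p.ν : Fin (F.P K).d → ℤ) κ ≤ 1 := le_trans (le_abs_self _) (abs_unitVec_apply_le p.ν κ)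
      simp only [Pi.add_apply]; linarith only [h.2, hℓ, h1, h2]
  have hNconeT : ∀ κ, (fun κ => z₀ κ + (ℓ0 : ℤ)) κ - (fun κ => z₀ κ - (ℓ0 : ℤ)) κ < (F.P K).sitesPerDir 0 := by
    intro κ; simp only; linarith only [hℓ0lt]
  have hboxeqT : Fintype.piFinset (fun i => Finset.Icc ((fun κ => z₀ κ - (ℓ0 : ℤ)) i) ((fun κ => z₀ κ + (ℓ0 : ℤ)) i)) = box z₀ (ℓ0 : ℤ) := rfl
  have hP3 : ∀ α : Fin 3, ∑ p : Plaq (F.P K) 0, linWeight j a p * ((I • pauli α) *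
        (((GaugeField.plaqHol V p : Matrix.specialUnitaryGroup (Fin 2) ℂ) : Matrix (Fin 2) (Fin 2) ℂ) - 1)).trace.re
      = (1 / 2) * ∑ z ∈ box z₀ (ℓ0 : ℤ), ∑ μ, ∑ ν, wt z μ ν * Fh α z μ ν := by
    intro α
    have h := UnitScaleGibbsChartPairingDictionary.sum_plaq_mul_eq_half_sum_box (P := F.P K) (j := 0) hNconeT
      (fun p => linWeight j a p)
      (fun p => ((I • pauli α) * (((GaugeField.plaqHol V p : Matrix.specialUnitaryGroup (Fin 2) ℂ) : Matrix (Fin 2) (Fin 2) ℂ) - 1)).trace.re)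
      hconeT W' (Fh α) (fun z μ ν h => by rw [hW']; simp only [h, ↓reduceDIte])
      (fun z => hanti (fun μ ν h => linWeight j a ⟨castSite z, μ, ν, h⟩) (hW' z)) (hFh_lt α) (hFha α)
    rw [h, hboxeqT]
    congr 1
    refine Finset.sum_congr rfl fun z hz => Finset.sum_congr rfl fun μ _ => Finset.sum_congr rfl fun ν _ => ?_
    rw [hW'wt z hz μ ν]
  -- (I-a) THE PAIRING IDENTITY AND THE SD ROW; letters `T`, `SD`, `Bi`, `Col`
  obtain ⟨T, hT⟩ : ∃ T : Fin 3 → ℝ, ∀ α, T α = ∑ p : Plaq (F.P K) 0, linWeight j a p * ((I • pauli α) *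
      (((GaugeField.plaqHol V p : Matrix.specialUnitaryGroup (Fin 2) ℂ) : Matrix (Fin 2) (Fin 2) ℂ) - 1)).trace.re := ⟨_, fun _ => rfl⟩
  obtain ⟨SD, hSD⟩ : ∃ SD : Fin 3 → ℝ, ∀ α, SD α = ∑ y ∈ box z₀ (3 * (R : ℤ) + 2), ∑ μ, ∑ ν, daR y μ ν * Fh α y μ ν := ⟨_, fun _ => rfl⟩
  obtain ⟨Bi, hBi⟩ : ∃ Bi : Fin 3 → ℝ, ∀ α, Bi α =
      ∑ y ∈ box z₀ (3 * (R : ℤ) + 2), ∑ κ, ∑ μ, ∑ ν, (χ y * γt y κ μ ν) * (Fh α (y + unitVec κ) μ ν - Fh α y μ ν) := ⟨_, fun _ => rfl⟩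
  obtain ⟨Col, hCol⟩ : ∃ Col : Fin 3 → ℝ, ∀ α, Col α = ∑ y ∈ box z₀ (3 * (R : ℤ) + 2), ∑ μ, ∑ ν, σ y μ ν * Fh α y μ ν := ⟨_, fun _ => rfl⟩
  have hT2 : ∀ α, 2 * T α = SD α + Bi α - Col α := by
    intro α
    have h := GrossTransferStubLinTestPointwisePairing.wt_pairing_eq (le_of_eq hd.symm) z₀ ℓ0 R hℓR wt βt at' γt hwt_off hβt hat hγt χ hχ1 hχ0
      aR daR haR hdaR E1 C2 σ hE1 hC2 hσ (Fh α)
    rw [hT, hP3 α, h, hSD, hBi, hCol]; ring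
  have h4 : ∀ α : Fin 3, |actionDeriv (fundamentalRep (Fin 2)) (fun b => ((u0 b : ℝ) : ℂ) • (I • pauli α)) V + 1 / 4 * SD α|
      ≤ 14 * ((((F.P K).d - 1 : ℕ) : ℝ) * n * θ) * θ *
        (4 * (((F.P K).d : ℝ) - 1) * ∑ x ∈ Fintype.piFinset (fun i => Finset.Icc (lo i) (hi i)), ∑ μ : Fin (F.P K).d, |aR x μ|) := by
    intro α
    rw [hSD]
    exact GrossTransferStubLinTestPointwisePairing.sd_term_abs_le U hU' hθ0 hbox hnN hNbox z₀ R hlo hhi χ hχ0 at' aR haR daR hdaR haR1 u0 hu0 hu0off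
      α (Fh α) (hFh_lt α) (hFha α)
  -- ✓P6 in numbers (I-b), ✓P7 (px19's KNIT-E4)
  have h5 : ∀ α : Fin 3, |Bi α| ≤ 1312 * ((((F.P K).d - 1 : ℕ) : ℝ) * n * θ) ^ 2 *
      ((81 / 2) * (K₀ + 26 * C₁k * (((3 * R : ℕ) : ℝ) + ℓ0)) * ∑ μ, ∑ ν, ∑ y ∈ box z₀ (ℓ0 : ℤ), |wt y μ ν|) := by
    intro α
    rw [hBi, hK₀]
    exact GrossTransferStubLinTestPointwiseMasses.bianchi_abs_le F K hC₁k hK1 wt βt γt z₀ ℓ0 hβt hγt χ R hχ01 hχ0 U hU' hθ0 hbox hnN hsmall4 hlo hhi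
      hβanti α (Fh α) (hFh_lt α) (hFha α)
  obtain ⟨X₀, hX₀⟩ : ∃ X₀ : ℝ, X₀ = ∑ y ∈ box z₀ (3 * (R : ℤ) + 2), ∑ ν, |δσ y ν| * GaugeGroup.dist1 (V ⟨castSite y, ν⟩) ^ 2 := ⟨_, rfl⟩
  obtain ⟨Sσ, hSσ⟩ : ∃ Sσ : ℝ, Sσ = ∑ y ∈ box z₀ (3 * (R : ℤ) + 2), ∑ μ, ∑ ν, |σ y μ ν| := ⟨_, rfl⟩
  have h6 : ∀ α : Fin 3, Col α ^ 2 ≤ 128 * (W * X₀) + 2 * (44 * ((((F.P K).d - 1 : ℕ) : ℝ) * n * θ) ^ 2 * Sσ) ^ 2 := by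
    intro α
    have h7 := GrossTransferStubLinTestCollarTerm.collar_term_sq_le_of_letters U hU' hθ0 hbox hnN hsmall z₀ R hlo hhi βt at' γt χ E1 C2 σ δσ
      hβanti hγt hχ0 hE1 hC2 hσ hδσ α (Fh α) (hFh_lt α) (hFha α)
    rw [← hV] at h7
    rw [hCol, hX₀, hW, hSσ]
    exact h7
  -- the `ℓ¹` masses (I-b)
  have hSa := GrossTransferStubLinTestPointwiseMasses.aR_mass_le F K hC₁k hK1 wt βt at' z₀ ℓ0 hβt hat χ R hχ01 hχ0 aR haR
    (Fintype.piFinset (fun i => Finset.Icc (lo i) (hi i)))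
  rw [← hK₀] at hSa
  have hSσle := GrossTransferStubLinTestPointwiseMasses.sigma_abs_mass_le F K hC₁k hK1 wt βt at' γt z₀ ℓ0 hβt hat hγt χ R hχ01 E1 C2 σ hE1 hC2 hσ
  rw [← hK₀, ← hSσ] at hSσle
  -- ✓`sq_le_of_rows`
  have hD0 : 0 ≤ GaugeGroup.dist1 (GaugeField.plaqHol (Averaging.iter (fun i' => BlockAveraging.blockAvg (P := F.P K) (j := i') ℰp) j U) a) :=
    GaugeGroup.dist1_nonneg _
  simp only [← hT] at hD
  have hEC0 : 0 ≤ 44 * ((((F.P K).d - 1 : ℕ) : ℝ) * n * θ) ^ 2 * Sσ := by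
    have : 0 ≤ Sσ := by rw [hSσ]; exact Finset.sum_nonneg fun _ _ => Finset.sum_nonneg fun _ _ => Finset.sum_nonneg fun _ _ => abs_nonneg _
    positivity
  have hQ0 : 0 ≤ (1 / 2) * (((F.P K).L : ℝ) * (F.P K).L) ^ j * θ ^ 2 := by positivity
  have hsq := GrossTransferStubLinTestAssembly.sq_le_of_rows (Y := fun α => actionDeriv (fundamentalRep (Fin 2)) (fun b => ((u0 b : ℝ) : ℂ) • (I • pauli α)) V)
    hD0 hD hT2 h4 h5 h6 hEC0 hQ0 hρ0
  -- (N) THE SMALL TERMS IN NUMBERS, then the window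
  obtain ⟨Λ, hΛ⟩ : ∃ Λ : ℝ, Λ = (L : ℝ) ^ (4 * j + 9) := ⟨_, rfl⟩
  have hΛ1 : 1 ≤ Λ := by rw [hΛ]; exact one_le_pow₀ hL1
  have hN1 := GrossTransferStubLinTestWindows.one_add_mul_le_pow (F.P K) hd (L : ℝ) hPL hnle (j := j)
  have hd2 : (((F.P K).d - 1 : ℕ) : ℝ) = 2 := by rw [hd]; norm_num
  have hd2' : ((F.P K).d : ℝ) - 1 = 2 := by rw [hd]; norm_num
  have hnΛ : (n : ℝ) ≤ Λ := by
    have h := hN1; rw [hd2] at h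
    have hn0 : (0 : ℝ) ≤ n := Nat.cast_nonneg n
    rw [hΛ]; linarith only [h, hn0]
  have hsizeN : 3 * R + 4 + ℓ0 ≤ F.L ^ (4 * j + 8) := by
    have hL2 : 2 ≤ F.L := F.hL.2
    have hPLn : (F.P K).L = F.L := rfl
    have hLj : 1 ≤ F.L ^ j := Nat.one_le_pow _ _ (by omega)
    have hL3j : F.L ^ j ≤ F.L ^ (4 * j) := Nat.pow_le_pow_right (by omega) (by omega)
    have e4 : F.L ^ (4 * j) = F.L ^ j * F.L ^ (3 * j) := by rw [← pow_add]; congr 1; ring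
    have h4j : 1 ≤ F.L ^ (4 * j) := Nat.one_le_pow _ _ (by omega)
    have hRle : R ≤ (7 * F.L + 14) * F.L ^ (4 * j) := by
      rw [hR, hPLn, e4]
      have h1 : R₀ + 12 ≤ (7 * F.L + 14) * F.L ^ j := by
        calc R₀ + 12 ≤ (7 * F.L + 2) * F.L ^ j + 12 * F.L ^ j := Nat.add_le_add hR₀le (by simpa using Nat.mul_le_mul_left 12 hLj)
          _ = (7 * F.L + 14) * F.L ^ j := by ring
      calc (R₀ + 12) * F.L ^ (3 * j) ≤ ((7 * F.L + 14) * F.L ^ j) * F.L ^ (3 * j) := Nat.mul_le_mul_right _ h1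
        _ = (7 * F.L + 14) * (F.L ^ j * F.L ^ (3 * j)) := by ring
    have hℓle : ℓ0 ≤ (7 * F.L + 4) * F.L ^ (4 * j) := by
      calc ℓ0 = R₀ + 2 := hℓ0
        _ ≤ (7 * F.L + 2) * F.L ^ j + 2 := Nat.add_le_add_right hR₀le 2
        _ ≤ (7 * F.L + 2) * F.L ^ (4 * j) + 2 * F.L ^ (4 * j) :=
            Nat.add_le_add (Nat.mul_le_mul_left _ hL3j) (by simpa using Nat.mul_le_mul_left 2 h4j)
        _ = (7 * F.L + 4) * F.L ^ (4 * j) := by ring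
    have h8 : 28 * F.L + 50 ≤ F.L ^ 8 := by
      have h7 : 2 ^ 7 ≤ F.L ^ 7 := Nat.pow_le_pow_left hL2 7
      calc 28 * F.L + 50 ≤ 128 * F.L := by omega
        _ ≤ F.L ^ 7 * F.L := Nat.mul_le_mul_right _ (le_trans (by norm_num) h7)
        _ = F.L ^ 8 := by ring
    calc 3 * R + 4 + ℓ0 ≤ 3 * ((7 * F.L + 14) * F.L ^ (4 * j)) + 4 * F.L ^ (4 * j) + (7 * F.L + 4) * F.L ^ (4 * j) :=
          Nat.add_le_add (Nat.add_le_add (Nat.mul_le_mul_left 3 hRle) (by simpa using Nat.mul_le_mul_left 4 h4j)) hℓle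
      _ = (28 * F.L + 50) * F.L ^ (4 * j) := by ring
      _ ≤ F.L ^ 8 * F.L ^ (4 * j) := Nat.mul_le_mul_right _ h8
      _ = F.L ^ (4 * j + 8) := by rw [← pow_add]; ring_nf
  have hsΛ : (((3 * R + 3 : ℕ) : ℝ) + 1 + (ℓ0 : ℝ)) ≤ Λ := by
    have h1 : (((3 * R + 4 + ℓ0 : ℕ)) : ℝ) ≤ ((F.L ^ (4 * j + 8) : ℕ) : ℝ) := by exact_mod_cast hsizeN
    push_cast at h1 ⊢
    rw [hFL] at h1
    have h2 : (L : ℝ) ^ (4 * j + 8) ≤ Λ := by rw [hΛ]; exact pow_le_pow_right₀ hL1 (by omega)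
    linarith only [h1, h2]
  have hs0 : ((3 * R : ℕ) : ℝ) + 1 + (ℓ0 : ℝ) ≤ Λ := by push_cast at hsΛ ⊢; linarith only [hsΛ]
  have hs0' : ((3 * R : ℕ) : ℝ) + (ℓ0 : ℝ) ≤ Λ := by push_cast at hsΛ ⊢; linarith only [hsΛ]
  have hs3' : ((3 * R + 3 : ℕ) : ℝ) + (ℓ0 : ℝ) ≤ Λ := by push_cast at hsΛ ⊢; linarith only [hsΛ]
  have hs_nn : ∀ m : ℕ, (0 : ℝ) ≤ ((m : ℕ) : ℝ) + 1 + (ℓ0 : ℝ) := fun m => by positivity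
  have hs_nn' : ∀ m : ℕ, (0 : ℝ) ≤ ((m : ℕ) : ℝ) + (ℓ0 : ℝ) := fun m => by positivity
  have hM00 : 0 ≤ ∑ μ, ∑ ν', ∑ y ∈ box z₀ (ℓ0 : ℤ), |wt y μ ν'| :=
    Finset.sum_nonneg fun _ _ => Finset.sum_nonneg fun _ _ => Finset.sum_nonneg fun _ _ => abs_nonneg _
  have hM0Λ : ∑ μ, ∑ ν', ∑ y ∈ box z₀ (ℓ0 : ℤ), |wt y μ ν'| ≤ 9 * Λ := by
    refine hM0.trans ?_
    have : ((L : ℝ) ^ 2) ^ j ≤ Λ := by rw [hΛ, ← pow_mul]; exact pow_le_pow_right₀ hL1 (by omega)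
    linarith only [this]
  have hSa0 : 0 ≤ ∑ x ∈ Fintype.piFinset (fun i => Finset.Icc (lo i) (hi i)), ∑ μ : Fin (F.P K).d, |aR x μ| :=
    Finset.sum_nonneg fun _ _ => Finset.sum_nonneg fun _ _ => abs_nonneg _
  have hSσ0 : 0 ≤ Sσ := by rw [hSσ]; exact Finset.sum_nonneg fun _ _ => Finset.sum_nonneg fun _ _ => Finset.sum_nonneg fun _ _ => abs_nonneg _
  have hρle := GrossTransferStubLinTestWindows.rem_le (F.P K) hd (L : ℝ) hPL hnle (j := j) (θ := θ)
  have hEtot := GrossTransferStubLinTestPointwiseNumbers.small_terms_le (ESD := 14 * ((((F.P K).d - 1 : ℕ) : ℝ) * n * θ) * θ *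
      (4 * (((F.P K).d : ℝ) - 1) * ∑ x ∈ Fintype.piFinset (fun i => Finset.Icc (lo i) (hi i)), ∑ μ : Fin (F.P K).d, |aR x μ|))
    (BiB := 1312 * ((((F.P K).d - 1 : ℕ) : ℝ) * n * θ) ^ 2 *
      ((81 / 2) * (K₀ + 26 * C₁k * (((3 * R : ℕ) : ℝ) + ℓ0)) * ∑ μ, ∑ ν, ∑ y ∈ box z₀ (ℓ0 : ℤ), |wt y μ ν|))
    (EC := 44 * ((((F.P K).d - 1 : ℕ) : ℝ) * n * θ) ^ 2 * Sσ) (Q := (1 / 2) * (((F.P K).L : ℝ) * (F.P K).L) ^ j * θ ^ 2)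
    hL1 hj hΛ hnΛ hK₀0 hC₁k hM00 hM0Λ (hs_nn (3 * R)) hs0 (hs_nn' (3 * R)) hs0' hsΛ hs3' hSa0 hSa (by rw [hd2]) hSσ0 hSσle
    (by rw [hd2, hd2']; nlinarith only [hSa0, hθ0]) (by rw [hd2]) (by rw [hPL]) hρle
  have hEtot0 : 0 ≤ 6 * (14 * ((((F.P K).d - 1 : ℕ) : ℝ) * n * θ) * θ *
      (4 * (((F.P K).d : ℝ) - 1) * ∑ x ∈ Fintype.piFinset (fun i => Finset.Icc (lo i) (hi i)), ∑ μ : Fin (F.P K).d, |aR x μ|))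
      + 3 / 2 * (1312 * ((((F.P K).d - 1 : ℕ) : ℝ) * n * θ) ^ 2 *
        ((81 / 2) * (K₀ + 26 * C₁k * (((3 * R : ℕ) : ℝ) + ℓ0)) * ∑ μ, ∑ ν, ∑ y ∈ box z₀ (ℓ0 : ℤ), |wt y μ ν|))
      + (1 / 2) * (((F.P K).L : ℝ) * (F.P K).L) ^ j * θ ^ 2
      + (143 * (((((F.P K).d + 4) * (F.P K).L : ℕ) : ℝ) ^ 2 / 4) ^ 2 + ((F.P K).L : ℝ) ^ 4 +
          2 * ((((F.P K).d + 4) * (F.P K).L : ℕ) : ℝ) * ((F.P K).L : ℝ) ^ 2) *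
        ((((F.P K).L : ℝ) ^ 2 + 143 * (((((F.P K).d + 4) * (F.P K).L : ℕ) : ℝ) ^ 2 / 4) ^ 2 +
            6 * (((((F.P K).d + 2) * (F.P K).L : ℕ) : ℝ) ^ 2 / 4) + (F.P K).L) ^ 2 +
          (((F.P K).L : ℝ) ^ 2 + 2 * ((((F.P K).d + 4) * (F.P K).L : ℕ) : ℝ) * ((F.P K).L : ℝ) ^ 2)) ^ j *
        ((1 + (((F.P K).d - 1 : ℕ) : ℝ) * n) * θ) ^ 2
      + 3 * (44 * ((((F.P K).d - 1 : ℕ) : ℝ) * n * θ) ^ 2 * Sσ) := by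
    have hη0' : 0 ≤ (((F.P K).d - 1 : ℕ) : ℝ) * n * θ := mul_nonneg (mul_nonneg (Nat.cast_nonneg _) (Nat.cast_nonneg _)) hθ0
    have hd1 : (0 : ℝ) ≤ ((F.P K).d : ℝ) - 1 := by rw [hd2']; norm_num
    have h1 : 0 ≤ 14 * ((((F.P K).d - 1 : ℕ) : ℝ) * n * θ) * θ *
        (4 * (((F.P K).d : ℝ) - 1) * ∑ x ∈ Fintype.piFinset (fun i => Finset.Icc (lo i) (hi i)), ∑ μ : Fin (F.P K).d, |aR x μ|) :=
      mul_nonneg (mul_nonneg (mul_nonneg (by norm_num) hη0') hθ0) (mul_nonneg (mul_nonneg (by norm_num) hd1) hSa0)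
    have hs00 : 0 ≤ K₀ + 26 * C₁k * (((3 * R : ℕ) : ℝ) + ℓ0) :=
      add_nonneg hK₀0 (mul_nonneg (mul_nonneg (by norm_num) hC₁k) (hs_nn' (3 * R)))
    have h2 : 0 ≤ 1312 * ((((F.P K).d - 1 : ℕ) : ℝ) * n * θ) ^ 2 *
        ((81 / 2) * (K₀ + 26 * C₁k * (((3 * R : ℕ) : ℝ) + ℓ0)) * ∑ μ, ∑ ν, ∑ y ∈ box z₀ (ℓ0 : ℤ), |wt y μ ν|) :=
      mul_nonneg (mul_nonneg (by norm_num) (sq_nonneg _)) (mul_nonneg (mul_nonneg (by norm_num) hs00) hM00)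
    linarith only [h1, h2, hQ0, hρ0, hEC0]
  rw [← hCE] at hEtot
  have hwinE := GrossTransferStubLinTestAssembly.sq_le_of_window' j hL1 hy0.le hy16 hθy hwinNat hEtot0 hEtot (by omega)
  -- the ω-fold: `864·W·X₀ ≤ Σ_b (9/2)ω_b·dist₁(V b)²`
  have hW0 : 0 ≤ W := by rw [hW]; exact Finset.sum_nonneg fun _ _ => Finset.sum_nonneg fun _ _ => abs_nonneg _
  have hfold : 864 * (W * X₀) ≤ ∑ b : PBond (F.P K) 0, (9 / 2 * ω b) * GaugeGroup.dist1 (V b) ^ 2 := by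
    have hf0 : ∀ (y : Zd (F.P K).d) (ν : Fin (F.P K).d), (0 : ℝ) ≤ (9 / 2) * (192 * W * |δσ y ν|) := fun y ν =>
      mul_nonneg (by norm_num) (mul_nonneg (mul_nonneg (by norm_num) hW0) (abs_nonneg _))
    have hA9 : ∀ (x : Fin (F.P K).d → ℤ) (μ : Fin (F.P K).d), lo ≤ x → x + e μ ≤ hi →
        (fun b : PBond (F.P K) 0 => 9 / 2 * ω b) ⟨castSite x, μ⟩ = (9 / 2) * (192 * W * |δσ x μ|) :=
      fun x μ hx hxμ => by show 9 / 2 * ω ⟨castSite x, μ⟩ = _; rw [hω x μ hx hxμ]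
    have hA90 : ∀ b : PBond (F.P K) 0, (¬ ∃ y : Fin (F.P K).d → ℤ, lo ≤ y ∧ y + e b.dir ≤ hi ∧ b.src = castSite y) →
        (fun b : PBond (F.P K) 0 => 9 / 2 * ω b) b = 0 := fun b hb => by show 9 / 2 * ω b = 0; rw [hωoff b hb, mul_zero]
    have h := GrossTransferStubLinTestAssembly.sum_box_mul_le_sum_pbond hNbox z₀ R hlo hhi
      (fun y ν => (9 / 2) * (192 * W * |δσ y ν|)) hf0 (fun b => 9 / 2 * ω b) hA9 hA90 (fun b => GaugeGroup.dist1 (V b) ^ 2) (fun b => sq_nonneg _)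
    refine le_trans (le_of_eq ?_) h
    rw [hX₀, ← mul_assoc, Finset.mul_sum _ _ (864 * W)]
    refine Finset.sum_congr rfl fun y _ => ?_
    rw [Finset.mul_sum _ _ (864 * W)]
    refine Finset.sum_congr rfl fun ν _ => ?_
    ring
  -- assembly
  have hxL : x * (L : ℝ) ^ j = γ * ((L : ℝ)⁻¹) ^ (K - j) := by
    rw [hx]
    have hL0 : (L : ℝ) ≠ 0 := by have := hL1; positivity
    have hjK' : j ≤ K := by omega
    rw [inv_pow, inv_pow, pow_sub₀ _ hL0 hjK', mul_inv, inv_inv]; ring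
  have hS0 : 0 ≤ ∑ α : Fin 3, (actionDeriv (fundamentalRep (Fin 2)) (fun b => ((u0 b : ℝ) : ℂ) • (I • pauli α)) V) ^ 2 :=
    Finset.sum_nonneg fun _ _ => sq_nonneg _
  have hxLj0 : 0 ≤ x * (L : ℝ) ^ j := by positivity
  rw [← hxL]
  have h1 : 36 * ∑ α : Fin 3, (fun α => actionDeriv (fundamentalRep (Fin 2)) (fun b => ((u0 b : ℝ) : ℂ) • (I • pauli α)) V) α ^ 2
      ≤ C * ∑ α : Fin 3, (actionDeriv (fundamentalRep (Fin 2)) (fun b => ((u0 b : ℝ) : ℂ) • (I • pauli α)) V) ^ 2 :=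
    mul_le_mul_of_nonneg_right hCge36 hS0
  have h3 : 3 * (CE ^ 2 * (x * (L : ℝ) ^ j)) ≤ C * (x * (L : ℝ) ^ j) := by
    calc 3 * (CE ^ 2 * (x * (L : ℝ) ^ j)) = C8 * (x * (L : ℝ) ^ j) := by rw [hC8]; ring
      _ ≤ C * (x * (L : ℝ) ^ j) := mul_le_mul_of_nonneg_right hCge8 hxLj0
  linarith only [hsq, h1, hfold, hwinE, h3]

end Summit.QuantumFields.YangMills.Theorems.GrossTransferStubLinTestPointwiseRow

end
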